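import Literature.RingTheory.TightClosure.CartierModuleNilpotence
import Literature.AlgebraicGeometry.Resolution.FFinite
import Mathlib.FieldTheory.Finite.GaloisField
import Mathlib.RingTheory.Spectrum.Prime.Topology
import Mathlib.RingTheory.Finiteness.Defs
import Mathlib.RingTheory.Noetherian.Defs
import HarnessLib

/-!
# Finiteness theorems for Cartier modules (Blickle–Böckle 2011) — named facts

Topic: `Literature/RingTheory/TightClosure`. The three structural results of Blickle–Böckle on
coherent Cartier modules `(M, C)` (`CartierModule.lean`), in the affine case `X = Spec R`, recorded
as NAMED FACTS (users take `(h : BlickleBockle2011_thm46)` etc.):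

* `BlickleBockle2011_prop214` — **the chain of images `M ⊇ C(M) ⊇ C²(M) ⊇ …` is eventually
  constant** (Prop. 2.14, due to Gabber; no F-finiteness needed). Consequences recorded in
  `CartierModule.lean` / `CartierModuleNilpotence.lean` under the hypothesis "constant from `n₀`
  on": `stableImage_eq_iterImage`, `image_stableImage` (`C(σ(M)) = σ(M)`, Cor. 2.15),
  `crysSupport_eq_of_stable`.
* `BlickleBockle2011_thm46` — **Main Theorem** (Thm. 4.6): for `R` F-finite, every descending
  chain `N₀ ⊇ N₁ ⊇ …` of Cartier submodules of a finitely generated Cartier module stabilises up to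
  nilpotence: for `i ≫ 0` the Cartier quotients `Nᵢ/Nᵢ₊₁` are nilpotent, i.e. `Cⁿ(Nᵢ) ⊆ Nᵢ₊₁` for
  some `n` (`CartierModule.isNilpotent_quotient_iff`).
* `BlickleBockle2011_prop49` — **finitely many supports** (Prop. 4.9 with Lemma 4.8): for `R`
  F-finite, the collection `crysSupports 𝒞 = {Supp_crys(M/N) | N a Cartier submodule}` is finite
  and consists of the finite unions of its finitely many irreducible members (the "centres"). The
  version of the introduction — for SURJECTIVE `C`, `{Supp(M/N)}` is finite — is the proved
  corollary `BlickleBockle2011_prop49.finite_support_quotient` (`Supp_crys = Supp` for surjective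
  structural maps, Lemma 3.16 (a), and surjectivity passes to quotients).

Hypotheses, as printed. Blickle–Böckle fix a prime `p`, `q = p^e` (`e ≥ 1`) and work with locally
Noetherian schemes over `𝔽_q` (Notation and Conventions, p. 5), `F` = the `q`-power Frobenius,
"`X` is F-finite" = `F` is a finite morphism; "coherent" = finitely generated. Rendered: `0 < e`,
`[Algebra (GaloisField p e) R]` (an `𝔽_q`-algebra structure), `[IsNoetherianRing R]`,
`IsFFinite p e R` (`R = ∑ᵢ R^q sᵢ`, `Literature.AlgebraicGeometry.Resolution.IsFFinite`, i.e.
`F^e_* R` module-finite), `[Module.Finite R M]`. Over a ring of characteristic `p` the case `e = 1`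
needs no `𝔽_q`-structure beyond `CharP R p`: corollaries `….of_charP`. (Blickle–Schwede 2012, §8.1
states all three results for schemes of finite type over any perfect field of characteristic `p`,
with the same proofs.) Supports are taken set-theoretically in `PrimeSpectrum R`
(`Module.support`); the reduced scheme structures of Lemma 3.13 / Prop. 4.9 are not recorded.

What is NOT here: the proofs (Gabber's `Supp(Cⁿ M/Cⁿ⁺¹ M)` argument for 2.14; 4.1–4.6 via duality
for the finite Frobenius); Cartier crystals and finite length (Cor. 4.7), `Hom` finiteness
(Thm. 4.17), finitely many submodules up to nilpotence (Cor. 4.20), the F-split case (Prop. 5.4).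

## Sources

* [BlickleBockle2011] M. Blickle, G. Böckle, *Cartier modules: finiteness results*, J. reine
  angew. Math. 661 (2011) 85–123 = arXiv:0909.2531 (numbering of the arXiv version, read: Prop. 2.14,
  Cor. 2.15, Lemma 3.16, Thm. 4.6, Lemma 4.8, Prop. 4.9; conventions p. 5).
* [BlickleSchwede2012] M. Blickle, K. Schwede, *`p⁻¹`-linear maps in algebra and geometry*,
  arXiv:1205.4577, §8.1.
-/

noncomputable section

namespace Literature.RingTheory.TightClosure

open Literature.AlgebraicGeometry.Resolution

universe u v

namespace CartierModule

variable {p e : ℕ} {R : Type u} {M : Type v} [CommRing R] [AddCommGroup M] [Module R M]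

/-- The collection `𝒮 = {Supp_crys(M/N) | N ⊆ M a Cartier submodule}` of crystalline supports of
the Cartier quotients of `M`. [cite: BlickleBockle2011, Lemma 4.8] -/
def crysSupports (𝒞 : CartierModule p e R M) : Set (Set (PrimeSpectrum R)) :=
  {Z | ∃ (N : Submodule R M) (hN : 𝒞.IsSubmodule N), (𝒞.quotient N hN).crysSupport = Z}

/-- `Supp_crys(M/N) ∈ 𝒮`. [folklore] -/
theorem crysSupport_quotient_mem (𝒞 : CartierModule p e R M) {N : Submodule R M}
    (hN : 𝒞.IsSubmodule N) : (𝒞.quotient N hN).crysSupport ∈ 𝒞.crysSupports :=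
  ⟨N, hN, rfl⟩

/-- `∅ = Supp_crys(M/M) ∈ 𝒮`. [folklore] -/
theorem empty_mem_crysSupports (𝒞 : CartierModule p e R M) : ∅ ∈ 𝒞.crysSupports := by
  refine ⟨⊤, 𝒞.isSubmodule_top, Set.eq_empty_of_subset_empty ?_⟩
  refine (crysSupport_subset_support _).trans ?_
  rw [Module.support_eq_empty]

/-- For a SURJECTIVE structural map, the supports `Supp(M/N)` of the quotients by Cartier
submodules all lie in `𝒮` (`Supp_crys(M/N) = Supp(M/N)` as `C` stays surjective on `M/N`).
[cite: BlickleBockle2011, Lemma 3.16 (a)] -/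
theorem support_quotient_mem_crysSupports {𝒞 : CartierModule p e R M} (h : 𝒞.IsSurjective)
    {N : Submodule R M} (hN : 𝒞.IsSubmodule N) : Module.support R (M ⧸ N) ∈ 𝒞.crysSupports :=
  ⟨N, hN, crysSupport_eq_support (h.quotient hN)⟩

end CartierModule

/-! ## The named facts -/

/-- NAMED FACT — **Blickle–Böckle 2011, Prop. 2.14 (Gabber): the images of the iterated structural
map stabilise.** *"Let `(M, C)` be a coherent Cartier module on `X`. Then the descending sequence of
images `Cⁱ(M)`, `M ⊇ C(M) ⊇ C²(M) ⊇ …`, stabilizes."* (`X` locally Noetherian over `𝔽_q`, `q = p^e`;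
"note that we do not assume `X` to be F-finite".) Affine rendering: `R` a Noetherian
`𝔽_q`-algebra, `M` a finitely generated `R`-module with a Cartier structure `𝒞` at level `e ≥ 1`;
then `Cⁿ(M) = Cⁿ⁰(M)` for all `n ≥ n₀`. Users take `(h : BlickleBockle2011_prop214)`.
[cite: BlickleBockle2011, Prop. 2.14] -/
def BlickleBockle2011_prop214 : Prop :=
  ∀ (p e : ℕ) [Fact p.Prime], 0 < e →
    ∀ (R : Type) [CommRing R] [Algebra (GaloisField p e) R] [IsNoetherianRing R]
      (M : Type) [AddCommGroup M] [Module R M] [Module.Finite R M] (𝒞 : CartierModule p e R M),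
      ∃ n₀ : ℕ, ∀ n : ℕ, n₀ ≤ n → 𝒞.iterImage n ⊤ = 𝒞.iterImage n₀ ⊤

/-- NAMED FACT — **Blickle–Böckle 2011, Thm. 4.6 (Main Theorem: descending chains of Cartier
submodules stabilise up to nilpotence).** *"Let `X` be a scheme satisfying Proposition 4.1 (e.g. `X`
is F-finite) and `M` a coherent Cartier module. Then any descending chain `M ⊇ M₁ ⊇ M₂ ⊇ M₃ ⊇ …`
of Cartier submodules of `M` stabilizes up to nilpotence. This means that for `i ≫ 0` the quotients
`Mᵢ/Mᵢ₊₁` are nilpotent."* Affine rendering: `R` a Noetherian F-finite `𝔽_q`-algebra (`q = p^e`,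
`e ≥ 1`), `M` finitely generated with Cartier structure `𝒞`, `N : ℕ → Submodule R M` antitone with
every `N i` a Cartier submodule; then for `i ≥ i₀` some iterated image `Cⁿ(N i)` lies in `N (i+1)`
(= the Cartier quotient `N i / N (i+1)` is nilpotent, `CartierModule.isNilpotent_quotient_iff`).
Users take `(h : BlickleBockle2011_thm46)`. [cite: BlickleBockle2011, Thm. 4.6] -/
def BlickleBockle2011_thm46 : Prop :=
  ∀ (p e : ℕ) [Fact p.Prime], 0 < e →
    ∀ (R : Type) [CommRing R] [Algebra (GaloisField p e) R] [IsNoetherianRing R], IsFFinite p e R →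
      ∀ (M : Type) [AddCommGroup M] [Module R M] [Module.Finite R M] (𝒞 : CartierModule p e R M)
        (N : ℕ → Submodule R M), Antitone N → (∀ i, 𝒞.IsSubmodule (N i)) →
        ∃ i₀ : ℕ, ∀ i : ℕ, i₀ ≤ i → ∃ n : ℕ, 𝒞.iterImage n (N i) ≤ N (i + 1)

/-- NAMED FACT — **Blickle–Böckle 2011, Prop. 4.9 (finitely many supports).** *"Let `X` be F-finite
and `M` a coherent Cartier module. Then the collection `{Y = Supp_crys M/N | N a Cartier submodule
of M}` is a finite collection of reduced subschemes of `X`. In fact, it consists of the finite unions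
of the finitely many irreducible subschemes in the collection."* Affine, set-theoretic rendering:
`R` a Noetherian F-finite `𝔽_q`-algebra (`q = p^e`, `e ≥ 1`), `M` finitely generated with Cartier
structure `𝒞`; then `𝒮 = CartierModule.crysSupports 𝒞 ⊆ 𝒫(Spec R)` is finite, and a subset of
`Spec R` lies in `𝒮` iff it is a union of irreducible members of `𝒮`. Users take
`(h : BlickleBockle2011_prop49)`. [cite: BlickleBockle2011, Prop. 4.9] -/
def BlickleBockle2011_prop49 : Prop :=
  ∀ (p e : ℕ) [Fact p.Prime], 0 < e →
    ∀ (R : Type) [CommRing R] [Algebra (GaloisField p e) R] [IsNoetherianRing R], IsFFinite p e R →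
      ∀ (M : Type) [AddCommGroup M] [Module R M] [Module.Finite R M] (𝒞 : CartierModule p e R M),
        𝒞.crysSupports.Finite ∧
          ∀ Z : Set (PrimeSpectrum R), Z ∈ 𝒞.crysSupports ↔
            ∃ T ⊆ {Y ∈ 𝒞.crysSupports | IsIrreducible Y}, ⋃₀ T = Z

/-! ## Proved consequences -/

/-- **Prop. 4.9 for a surjective structural map (the form of the introduction):** *"Let `X` be an
F-finite scheme, and `(M, C)` a coherent Cartier module with surjective structural map `C`. Then the
set `{Supp(M/N) | N ⊆ M a Cartier submodule}` is a finite collection …"* — from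
`BlickleBockle2011_prop49`, since for surjective `C` every `Supp(M/N)` is a `Supp_crys(M/N)`.
[cite: BlickleBockle2011, Prop. 4.9 (Theorem on p. 5 of the introduction)] -/
theorem BlickleBockle2011_prop49.finite_support_quotient (h : BlickleBockle2011_prop49) (p e : ℕ)
    [Fact p.Prime] (he : 0 < e) (R : Type) [CommRing R] [Algebra (GaloisField p e) R]
    [IsNoetherianRing R] (hF : IsFFinite p e R) (M : Type) [AddCommGroup M] [Module R M]
    [Module.Finite R M] (𝒞 : CartierModule p e R M) (h𝒞 : 𝒞.IsSurjective) :
    {Z : Set (PrimeSpectrum R) |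
      ∃ N : Submodule R M, 𝒞.IsSubmodule N ∧ Module.support R (M ⧸ N) = Z}.Finite := by
  refine (h p e he R hF M 𝒞).1.subset ?_
  rintro _ ⟨N, hN, rfl⟩
  exact CartierModule.support_quotient_mem_crysSupports h𝒞 hN

/-- The `𝔽_p`-algebra structure of a ring of characteristic `p`, transported to `GaloisField p 1`
(`≅ ZMod p`), used to specialise the facts to `e = 1`. [folklore] -/
abbrev algebraGaloisFieldOne (p : ℕ) [Fact p.Prime] (R : Type u) [CommRing R] [CharP R p] :
    Algebra (GaloisField p 1) R :=
  ((ZMod.castHom (dvd_refl p) R).comp (GaloisField.equivZmodP p).toRingEquiv.toRingHom).toAlgebra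

/-- **Prop. 2.14 at `q = p`** for any Noetherian ring of characteristic `p` (an `𝔽_p`-algebra).
[cite: BlickleBockle2011, Prop. 2.14] -/
theorem BlickleBockle2011_prop214.of_charP (h : BlickleBockle2011_prop214) (p : ℕ) [Fact p.Prime]
    (R : Type) [CommRing R] [CharP R p] [IsNoetherianRing R] (M : Type) [AddCommGroup M]
    [Module R M] [Module.Finite R M] (𝒞 : CartierModule p 1 R M) :
    ∃ n₀ : ℕ, ∀ n : ℕ, n₀ ≤ n → 𝒞.iterImage n ⊤ = 𝒞.iterImage n₀ ⊤ := by
  letI := algebraGaloisFieldOne p R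
  exact h p 1 Nat.one_pos R M 𝒞

/-- **Thm. 4.6 at `q = p`** for any Noetherian F-finite ring of characteristic `p`.
[cite: BlickleBockle2011, Thm. 4.6] -/
theorem BlickleBockle2011_thm46.of_charP (h : BlickleBockle2011_thm46) (p : ℕ) [Fact p.Prime]
    (R : Type) [CommRing R] [CharP R p] [IsNoetherianRing R] (hF : IsFFinite p 1 R) (M : Type)
    [AddCommGroup M] [Module R M] [Module.Finite R M] (𝒞 : CartierModule p 1 R M)
    (N : ℕ → Submodule R M) (hN : Antitone N) (hC : ∀ i, 𝒞.IsSubmodule (N i)) :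
    ∃ i₀ : ℕ, ∀ i : ℕ, i₀ ≤ i → ∃ n : ℕ, 𝒞.iterImage n (N i) ≤ N (i + 1) := by
  letI := algebraGaloisFieldOne p R
  exact h p 1 Nat.one_pos R hF M 𝒞 N hN hC

/-- **Prop. 4.9 at `q = p`** for any Noetherian F-finite ring of characteristic `p`.
[cite: BlickleBockle2011, Prop. 4.9] -/
theorem BlickleBockle2011_prop49.of_charP (h : BlickleBockle2011_prop49) (p : ℕ) [Fact p.Prime]
    (R : Type) [CommRing R] [CharP R p] [IsNoetherianRing R] (hF : IsFFinite p 1 R) (M : Type)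
    [AddCommGroup M] [Module R M] [Module.Finite R M] (𝒞 : CartierModule p 1 R M) :
    𝒞.crysSupports.Finite ∧
      ∀ Z : Set (PrimeSpectrum R), Z ∈ 𝒞.crysSupports ↔
        ∃ T ⊆ {Y ∈ 𝒞.crysSupports | IsIrreducible Y}, ⋃₀ T = Z := by
  letI := algebraGaloisFieldOne p R
  exact h p 1 Nat.one_pos R hF M 𝒞

/-- With `BlickleBockle2011_prop214` the stable image has surjective structural map,
`C(σ(M)) = σ(M)`, for every finitely generated Cartier module over a Noetherian `𝔽_q`-algebra.
[cite: BlickleBockle2011, Cor. 2.15] -/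
theorem BlickleBockle2011_prop214.image_stableImage (h : BlickleBockle2011_prop214) (p e : ℕ)
    [Fact p.Prime] (he : 0 < e) (R : Type) [CommRing R] [Algebra (GaloisField p e) R]
    [IsNoetherianRing R] (M : Type) [AddCommGroup M] [Module R M] [Module.Finite R M]
    (𝒞 : CartierModule p e R M) : 𝒞.image 𝒞.stableImage = 𝒞.stableImage := by
  obtain ⟨n₀, hn₀⟩ := h p e he R M 𝒞
  exact CartierModule.image_stableImage (hn₀ (n₀ + 1) n₀.le_succ)

end Literature.RingTheory.TightClosure

end
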